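import Literature.Computability.QuantumComplexity.QAOALevelOneMaxCut
import Mathlib.Algebra.Order.ToIntervalMod
import Mathlib.Topology.Instances.Matrix
import HarnessLib

/-!
# QAOA angles live on a torus; `M_p` is an attained maximum (Farhi–Goldstone–Gutmann 2014, §1, eq. (8))

Topic `Literature/Computability/QuantumComplexity` (pub-qadeq lane); companion to
`QAOALevelOneMaxCut.lean` (`qaoaUnitaryP`, `meanCut` = `F_p` as the mean of the measured cut,
`maxLevel` = FGG's `M_p` taken there as a supremum over all real angles, `costUnitary_add_two_pi`),
kept separate because the parent file is at the gate's size limit. FGG §1: “Because `C` has integer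
eigenvalues we can restrict `γ` to lie between `0` and `2π`”, “`U(B, β) = e^{−iβB} = ∏_j
e^{−iβσ^x_j}` where `β` runs from `0` to `π`”, “`M_p = max_{γ,β} F_p(γ, β)`” (8), “angles `(γ, β)`
chosen from a fine grid on the compact set `[0, 2π]^p × [0, π]^p`”. This file PROVES that `F_p` is
`2π`-periodic in each `γ_j` and `π`-periodic in each `β_j` (the mixer layer changes by the global sign
`(−1)^n`, the state by a phase), that `F_p` is continuous in the angles, and hence that the supremum
`M_p` of the parent file IS a maximum, attained on the printed compact box — making (8) literal.

HONEST FRAMING: instance-level adjudication of specific advantage claims; no claim about BQP vs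
BPP or the summit. Elementary facts about the ansatz; nothing about any device.

## Source (held text, read at the cited places)

* [FarhiGoldstoneGutmann2014] E. Farhi, J. Goldstone, S. Gutmann, arXiv:1411.4028 (`lit read
  arxiv:1411.4028`, tex chunk p0003 = §1): the sentences quoted above around eqs. (2), (4), (8), and
  “If `p` doesn't grow with `n`, one possibility is to run the quantum computer with angles `(γ, β)`
  chosen from a fine grid on the compact set `[0, 2π]^p × [0, π]^p`”.

* [Jukna2011] S. Jukna, *Extremal Combinatorics*, 2nd ed., Springer 2011, Thm. 26.1 (Erdős; “E[X_e] =
  1/2 as two fair coin flips have probability 1/2 of being different … E[X] = |E|/2”), as already used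
  by the tree's `Literature/Combinatorics/SimpleGraph/RandomCutBaseline.lean` (which proves the same
  average for the `Fin N` / `cutSize` vocabulary of `HardcoreInapproximability`; not imported here to
  keep this file off `import Mathlib`).
* [Hastings2019BoundedDepth] M. B. Hastings, arXiv:1905.07047 = Quantum Inf. Comput. 19 (2019) 1116, §3: “we will
  say that an algorithm improves by a factor δ over random if the expected fraction of cut edges is at
  least 1/2 + δ.”

## What is formalised

* `mixerGate_add_pi` (`e^{−i(β+π)σ^x} = −e^{−iβσ^x}`), **`mixUnitary_add_pi`** (`U(B, β+π) = (−1)^n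
  U(B, β)`); per-layer versions for the level-`p` circuit, **`qaoaUnitaryP_update_gamma`**
  (`γ_j ↦ γ_j + 2π` leaves `U` unchanged) and **`qaoaUnitaryP_update_beta`** (`β_j ↦ β_j + π`
  multiplies `U` by `(−1)^n`), hence `meanCut_update_gamma` / `meanCut_update_beta` and, for integer
  multiples, `meanCut_update_gamma_zsmul` / `meanCut_update_beta_zsmul`; **`meanCut_eq_meanCut_toIcoMod`**
  (reduction of all `2p` angles to the box `[0, 2π)^p × [0, π)^p`).
* Continuity: `continuous_mixUnitary`, `continuous_costUnitary`, **`continuous_qaoaUnitaryP`** (jointly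
  in `(γ, β)`), **`continuous_meanCut`**.
* **`exists_meanCut_eq_maxLevel`**: there are angles in `[0, 2π]^p × [0, π]^p` at which
  `F_p = M_p` (“`M_p = max_{γ,β} F_p`”, eq. (8), with the printed compact domain).
* (v2) the random baseline: `outcomeProb_zero` (`|⟨z|s⟩|² = 2^{−n}`), `two_mul_card_filter_ne` (“two
  fair coin flips”), **`two_mul_sum_cutValue`** (`Σ_z C(z) = |E|·2^{n−1}`), **`meanCut_zero`** /
  `maxLevel_zero` (`F_0 = M_0 = |E|/2`) and **`half_card_le_maxLevel`** (`M_p ≥ |E|/2`, via (9)).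
* NOT formalised: the limit (10), derivative bounds (“the partial derivatives of `F_p` … are bounded
  by `O(m² + mn)`”), grid-search guarantees.

0 named facts, 0 sorry.
-/

noncomputable section

open Matrix Finset

namespace Literature.Computability.QuantumComplexity

namespace QAOA

variable {V : Type*} [Fintype V] [DecidableEq V] (G : SimpleGraph V) [DecidableRel G.Adj]

/-! ### `β`-periodicity of the mixer -/

omit [Fintype V] [DecidableEq V] in
/-- `e^{−i(β+π)σ^x} = −e^{−iβσ^x}`. [cite: FarhiGoldstoneGutmann2014, §1 (eq. (4), “where β runs from
0 to π”)] -/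
theorem mixerGate_add_pi (β : ℝ) : mixerGate (β + Real.pi) = -mixerGate β := by
  rw [mixerGate, mixerGate, Real.cos_add_pi, Real.sin_add_pi]
  push_cast
  rw [neg_sub', neg_smul, mul_neg, neg_smul, sub_neg_eq_add, neg_add_eq_sub]

omit [DecidableEq V] in
/-- Plumbing: `⊗ (cᵢ • Aᵢ) = (∏ cᵢ) • ⊗ Aᵢ`. [folklore] -/
private theorem tensorAll_smul_fun' (c : V → ℂ) (A : V → Matrix Bool Bool ℂ) :
    tensorAll (fun i => c i • A i) = (∏ i, c i) • tensorAll A := by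
  ext x y
  simp only [tensorAll_apply, Matrix.smul_apply, smul_eq_mul, Finset.prod_mul_distrib]

omit [DecidableEq V] in
/-- **`U(B, β + π) = (−1)^n U(B, β)`**: the mixer is `π`-periodic up to a global sign. [cite:
FarhiGoldstoneGutmann2014, §1 (eq. (4), “where β runs from 0 to π”)] -/
theorem mixUnitary_add_pi (β : ℝ) :
    (mixUnitary (β + Real.pi) : Matrix (V → Bool) (V → Bool) ℂ) = (-1 : ℂ) ^ Fintype.card V • mixUnitary β := by
  rw [mixUnitary, mixUnitary]
  simp_rw [mixerGate_add_pi]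
  rw [show (fun _ : V => -mixerGate β) = fun _ : V => (-1 : ℂ) • mixerGate β by funext i; rw [neg_one_smul],
    tensorAll_smul_fun', Finset.prod_const, Finset.card_univ]

/-! ### Per-layer periodicity of the level-`p` circuit -/

/-- **`γ_j ↦ γ_j + 2π` leaves the level-`p` circuit unchanged.** [cite: FarhiGoldstoneGutmann2014, §1
(“Because C has integer eigenvalues we can restrict γ to lie between 0 and 2π”)] -/
theorem qaoaUnitaryP_update_gamma (p : ℕ) :
    ∀ (γ β : Fin p → ℝ) (j : Fin p),
      qaoaUnitaryP G p (Function.update γ j (γ j + 2 * Real.pi)) β = qaoaUnitaryP G p γ β := by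
  induction p with
  | zero => intro γ β j; exact j.elim0
  | succ p ih =>
    intro γ β j
    rw [qaoaUnitaryP, qaoaUnitaryP]
    rcases Fin.eq_castSucc_or_eq_last j with ⟨j', rfl⟩ | rfl
    · rw [Function.update_of_ne (Fin.castSucc_ne_last j').symm,
        Function.update_comp_eq_of_injective' γ (Fin.castSucc_injective p) j', ih]
    · rw [Function.update_self, costUnitary_add_two_pi]
      congr 2
      funext i
      exact Function.update_of_ne (Fin.castSucc_ne_last i) _ _

/-- **`β_j ↦ β_j + π` multiplies the level-`p` circuit by `(−1)^n`.** [cite: FarhiGoldstoneGutmann2014,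
§1 (eq. (4), “where β runs from 0 to π”)] -/
theorem qaoaUnitaryP_update_beta (p : ℕ) :
    ∀ (γ β : Fin p → ℝ) (j : Fin p),
      qaoaUnitaryP G p γ (Function.update β j (β j + Real.pi)) =
        (-1 : ℂ) ^ Fintype.card V • qaoaUnitaryP G p γ β := by
  induction p with
  | zero => intro γ β j; exact j.elim0
  | succ p ih =>
    intro γ β j
    rw [qaoaUnitaryP, qaoaUnitaryP]
    rcases Fin.eq_castSucc_or_eq_last j with ⟨j', rfl⟩ | rfl
    · rw [Function.update_of_ne (Fin.castSucc_ne_last j').symm,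
        Function.update_comp_eq_of_injective' β (Fin.castSucc_injective p) j', ih, Matrix.mul_smul]
    · rw [Function.update_self, mixUnitary_add_pi, Matrix.smul_mul, Matrix.smul_mul]
      congr 3
      funext i
      exact Function.update_of_ne (Fin.castSucc_ne_last i) _ _

/-- A global sign does not change the outcome distribution. [folklore] -/
private theorem meanCut_eq_of_smul {p : ℕ} {γ β γ' β' : Fin p → ℝ} {c : ℂ} (hc : ‖c‖ = 1)
    (h : qaoaUnitaryP G p γ' β' = c • qaoaUnitaryP G p γ β) : meanCut G p γ' β' = meanCut G p γ β := by
  unfold meanCut outcomeProb qaoaStateP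
  rw [h, Matrix.smul_mulVec]
  refine Finset.sum_congr rfl fun z _ => ?_
  rw [Pi.smul_apply, smul_eq_mul, norm_mul, hc, one_mul]

/-- **`F_p` is `2π`-periodic in each `γ_j`.** [cite: FarhiGoldstoneGutmann2014, §1 (“we can restrict
γ to lie between 0 and 2π”)] -/
theorem meanCut_update_gamma (p : ℕ) (γ β : Fin p → ℝ) (j : Fin p) :
    meanCut G p (Function.update γ j (γ j + 2 * Real.pi)) β = meanCut G p γ β :=
  meanCut_eq_of_smul G (c := 1) (by simp) (by rw [one_smul, qaoaUnitaryP_update_gamma])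

/-- **`F_p` is `π`-periodic in each `β_j`.** [cite: FarhiGoldstoneGutmann2014, §1 (“where β runs from
0 to π”)] -/
theorem meanCut_update_beta (p : ℕ) (γ β : Fin p → ℝ) (j : Fin p) :
    meanCut G p γ (Function.update β j (β j + Real.pi)) = meanCut G p γ β :=
  meanCut_eq_of_smul G (c := (-1 : ℂ) ^ Fintype.card V) (by simp) (qaoaUnitaryP_update_beta G p γ β j)

/-- Periodicity under a shift by an integer multiple, from the one-period shift. [folklore] -/
private theorem periodic_update_zsmul {p : ℕ} {f : (Fin p → ℝ) → ℝ} {T : ℝ}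
    (hf : ∀ (θ : Fin p → ℝ) (j : Fin p), f (Function.update θ j (θ j + T)) = f θ)
    (θ : Fin p → ℝ) (j : Fin p) (k : ℤ) : f (Function.update θ j (θ j + k • T)) = f θ := by
  induction k using Int.induction_on with
  | zero => rw [zero_smul, add_zero, Function.update_eq_self]
  | succ k ih =>
    have h := hf (Function.update θ j (θ j + (k : ℤ) • T)) j
    rw [Function.update_self, Function.update_idem] at h
    rw [add_smul, one_smul, ← add_assoc, h, ih]
  | pred k ih =>
    have h := hf (Function.update θ j (θ j + (-(k : ℤ) - 1) • T)) j
    rw [Function.update_self, Function.update_idem,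
      show θ j + (-(k : ℤ) - 1) • T + T = θ j + (-(k : ℤ)) • T by rw [sub_smul, one_smul]; ring] at h
    rw [← h, ih]

/-- `γ_j ↦ γ_j + 2πk`, `k ∈ ℤ`. [cite: FarhiGoldstoneGutmann2014, §1 (γ between 0 and 2π)] -/
theorem meanCut_update_gamma_zsmul (p : ℕ) (γ β : Fin p → ℝ) (j : Fin p) (k : ℤ) :
    meanCut G p (Function.update γ j (γ j + k • (2 * Real.pi))) β = meanCut G p γ β :=
  periodic_update_zsmul (f := fun θ => meanCut G p θ β) (fun θ j => meanCut_update_gamma G p θ β j) γ j k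

/-- `β_j ↦ β_j + πk`, `k ∈ ℤ`. [cite: FarhiGoldstoneGutmann2014, §1 (β between 0 and π)] -/
theorem meanCut_update_beta_zsmul (p : ℕ) (γ β : Fin p → ℝ) (j : Fin p) (k : ℤ) :
    meanCut G p γ (Function.update β j (β j + k • Real.pi)) = meanCut G p γ β :=
  periodic_update_zsmul (f := fun θ => meanCut G p γ θ) (fun θ j => meanCut_update_beta G p γ θ j) β j k

/-- Reducing every coordinate of `θ` modulo the period `T`. [folklore] -/
private theorem periodic_toIcoMod {p : ℕ} {f : (Fin p → ℝ) → ℝ} {T : ℝ} (hT : 0 < T)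
    (hf : ∀ (θ : Fin p → ℝ) (j : Fin p) (k : ℤ), f (Function.update θ j (θ j + k • T)) = f θ)
    (θ : Fin p → ℝ) : f (fun j => toIcoMod hT 0 (θ j)) = f θ := by
  classical
  suffices h : ∀ S : Finset (Fin p), f (fun j => if j ∈ S then toIcoMod hT 0 (θ j) else θ j) = f θ by
    simpa using h Finset.univ
  intro S
  induction S using Finset.induction_on with
  | empty => simp
  | insert a S ha ih =>
    have hstep := hf (fun j => if j ∈ S then toIcoMod hT 0 (θ j) else θ j) a (-toIcoDiv hT 0 (θ a))
    rw [← ih, ← hstep]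
    congr 1
    funext j
    by_cases hj : j = a
    · rw [hj, Function.update_self, if_pos (Finset.mem_insert_self a S), if_neg ha, neg_smul,
        ← sub_eq_add_neg, self_sub_toIcoDiv_zsmul]
    · rw [Function.update_of_ne hj]
      simp [Finset.mem_insert, hj]

/-- **All angles reduce to the box `[0, 2π)^p × [0, π)^p`** without changing `F_p`. [cite:
FarhiGoldstoneGutmann2014, §1 (“restrict γ to lie between 0 and 2π”, “β runs from 0 to π”, “the
compact set [0, 2π]^p × [0, π]^p”)] -/
theorem meanCut_eq_meanCut_toIcoMod (p : ℕ) (γ β : Fin p → ℝ) :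
    meanCut G p γ β = meanCut G p (fun j => toIcoMod Real.two_pi_pos 0 (γ j))
      (fun j => toIcoMod Real.pi_pos 0 (β j)) := by
  rw [periodic_toIcoMod Real.two_pi_pos (f := fun θ => meanCut G p θ _)
      (fun θ j k => meanCut_update_gamma_zsmul G p θ _ j k),
    periodic_toIcoMod Real.pi_pos (f := fun θ => meanCut G p γ θ)
      (fun θ j k => meanCut_update_beta_zsmul G p γ θ j k)]

/-! ### Continuity in the angles -/

omit [DecidableEq V] in
/-- `β ↦ U(B, β)` is continuous. [cite: FarhiGoldstoneGutmann2014, eq. (4)] -/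
theorem continuous_mixUnitary : Continuous fun β : ℝ => (mixUnitary β : Matrix (V → Bool) (V → Bool) ℂ) := by
  refine continuous_matrix fun x y => ?_
  simp only [mixUnitary, tensorAll_apply]
  refine continuous_finsetProd _ fun i _ => ?_
  simp only [mixerGate, Matrix.sub_apply, Matrix.smul_apply, smul_eq_mul]
  fun_prop

omit [DecidableEq V] in
/-- `γ ↦ U(C, γ)` is continuous. [cite: FarhiGoldstoneGutmann2014, eq. (2)] -/
theorem continuous_costUnitary : Continuous fun γ : ℝ => costUnitary G γ := by
  refine continuous_matrix fun x y => ?_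
  simp only [costUnitary, diagonal_apply]
  split_ifs
  · fun_prop
  · exact continuous_const

/-- **The level-`p` circuit is continuous in the `2p` angles.** [cite: FarhiGoldstoneGutmann2014, §1
(eqs. (6)–(8): F_p is maximised over the compact set [0,2π]^p × [0,π]^p)] -/
theorem continuous_qaoaUnitaryP (p : ℕ) :
    Continuous fun a : (Fin p → ℝ) × (Fin p → ℝ) => qaoaUnitaryP G p a.1 a.2 := by
  induction p with
  | zero => simp only [qaoaUnitaryP]; exact continuous_const
  | succ p ih =>
    simp only [qaoaUnitaryP]
    have h1 : Continuous fun a : (Fin (p + 1) → ℝ) × (Fin (p + 1) → ℝ) =>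
        ((fun i : Fin p => a.1 i.castSucc), (fun i : Fin p => a.2 i.castSucc)) :=
      (continuous_pi fun i => (continuous_apply i.castSucc).comp continuous_fst).prodMk
        (continuous_pi fun i => (continuous_apply i.castSucc).comp continuous_snd)
    have h2 := ih.comp h1
    have h3 : Continuous fun a : (Fin (p + 1) → ℝ) × (Fin (p + 1) → ℝ) =>
        (mixUnitary (a.2 (Fin.last p)) : Matrix (V → Bool) (V → Bool) ℂ) :=
      continuous_mixUnitary.comp ((continuous_apply (Fin.last p)).comp continuous_snd)
    have h4 : Continuous fun a : (Fin (p + 1) → ℝ) × (Fin (p + 1) → ℝ) => costUnitary G (a.1 (Fin.last p)) :=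
      (continuous_costUnitary G).comp ((continuous_apply (Fin.last p)).comp continuous_fst)
    exact (h3.matrix_mul h4).matrix_mul h2

/-- **`F_p` is continuous in the angles.** [cite: FarhiGoldstoneGutmann2014, §1 (eq. (8) and “the
partial derivatives of F_p(γ,β) … are bounded”)] -/
theorem continuous_meanCut (p : ℕ) : Continuous fun a : (Fin p → ℝ) × (Fin p → ℝ) => meanCut G p a.1 a.2 := by
  unfold meanCut outcomeProb qaoaStateP
  refine continuous_finsetSum _ fun z _ => continuous_const.mul ?_
  refine (continuous_norm.comp ?_).pow 2
  exact (continuous_apply z).comp ((continuous_qaoaUnitaryP G p).matrix_mulVec continuous_const)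

/-! ### `M_p` is an attained maximum on the compact box -/

/-- **FGG eq. (8), `M_p = max_{γ,β} F_p(γ,β)`, literally:** the supremum `maxLevel` of the parent file
is attained at some angles in the compact box `[0, 2π]^p × [0, π]^p`. [cite: FarhiGoldstoneGutmann2014,
eq. (8) and §1 (“angles (γ, β) chosen from a fine grid on the compact set [0, 2π]^p × [0, π]^p”)] -/
theorem exists_meanCut_eq_maxLevel (p : ℕ) :
    ∃ γ β : Fin p → ℝ, (∀ j, γ j ∈ Set.Icc 0 (2 * Real.pi)) ∧ (∀ j, β j ∈ Set.Icc 0 Real.pi) ∧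
      meanCut G p γ β = maxLevel G p := by
  let K : Set ((Fin p → ℝ) × (Fin p → ℝ)) :=
    (Set.univ.pi fun _ => Set.Icc 0 (2 * Real.pi)) ×ˢ (Set.univ.pi fun _ => Set.Icc 0 Real.pi)
  have hK : IsCompact K :=
    (isCompact_univ_pi fun _ => isCompact_Icc).prod (isCompact_univ_pi fun _ => isCompact_Icc)
  have hne : K.Nonempty := by
    refine ⟨(fun _ => 0, fun _ => 0), ?_, ?_⟩
    · rw [Set.mem_univ_pi]; intro j; exact ⟨le_rfl, by positivity⟩
    · rw [Set.mem_univ_pi]; intro j; exact ⟨le_rfl, Real.pi_pos.le⟩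
  obtain ⟨a, haK, hmax⟩ := hK.exists_isMaxOn hne (continuous_meanCut G p).continuousOn
  refine ⟨a.1, a.2, ?_, ?_, ?_⟩
  · intro j
    have := haK.1
    rw [Set.mem_univ_pi] at this
    exact this j
  · intro j
    have := haK.2
    rw [Set.mem_univ_pi] at this
    exact this j
  · refine le_antisymm (meanCut_le_maxLevel G p a.1 a.2) (ciSup_le fun b => ?_)
    rw [meanCut_eq_meanCut_toIcoMod]
    have hmax' := isMaxOn_iff.1 hmax
    refine hmax' ((fun j => toIcoMod Real.two_pi_pos 0 (b.1 j)), (fun j => toIcoMod Real.pi_pos 0 (b.2 j))) ⟨?_, ?_⟩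
    · rw [Set.mem_univ_pi]
      intro j
      have h := toIcoMod_mem_Ico' Real.two_pi_pos (b.1 j)
      exact ⟨h.1, h.2.le⟩
    · rw [Set.mem_univ_pi]
      intro j
      have h := toIcoMod_mem_Ico' Real.pi_pos (b.2 j)
      exact ⟨h.1, h.2.le⟩


/-! ### The random-assignment baseline: `F_0 = |E|/2 ≤ M_p`

At `p = 0` the circuit is empty and measuring `|s⟩` (FGG eq. (5), the uniform superposition) returns a
uniformly random string, whose expected cut is `|E|/2` (“two fair coin flips have probability 1/2 of
being different … E[X] = |E|/2”, Jukna Thm. 26.1; Hastings §3: “an algorithm improves by a factor `δ`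
over random if the expected fraction of cut edges is at least `1/2 + δ`”).  With FGG (9),
`M_p ≥ M_{p−1} ≥ ⋯ ≥ M_0 = |E|/2`. -/

/-- At `p = 0` the outcome distribution is uniform: `|⟨z|s⟩|² = 2^{−n}`. [cite:
FarhiGoldstoneGutmann2014, eq. (5) (“the uniform superposition over computational basis states”)] -/
theorem outcomeProb_zero (γ β : Fin 0 → ℝ) (z : V → Bool) :
    outcomeProb G 0 γ β z = ((2 : ℝ) ^ Fintype.card V)⁻¹ := by
  unfold outcomeProb qaoaStateP
  rw [qaoaUnitaryP, Matrix.one_mulVec, plusState, Complex.norm_real, Real.norm_eq_abs,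
    abs_of_nonneg (inv_nonneg.2 (Real.sqrt_nonneg _)), inv_pow, Real.sq_sqrt (by positivity)]

omit [DecidableEq V] in
/-- “Two fair coin flips have probability 1/2 of being different”: for `a ≠ b` exactly half of the
`2^n` strings separate `a` from `b`. [cite: Jukna2011, Thm. 26.1 (proof)] -/
theorem two_mul_card_filter_ne [DecidableEq V] {a b : V} (hab : a ≠ b) :
    2 * #(Finset.univ.filter fun z : V → Bool => z a ≠ z b) = 2 ^ Fintype.card V := by
  have hflip : ∀ z : V → Bool, flipAt z a a ≠ flipAt z a b ↔ z a = z b := by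
    intro z
    rw [flipAt, Function.update_self, Function.update_of_ne hab.symm]
    cases z a <;> cases z b <;> decide
  have hcard : #(Finset.univ.filter fun z : V → Bool => z a ≠ z b) =
      #(Finset.univ.filter fun z : V → Bool => ¬ z a ≠ z b) := by
    refine Finset.card_bij' (fun z _ => flipAt z a) (fun z _ => flipAt z a) ?_ ?_ ?_ ?_
    · intro z hz
      rw [Finset.mem_filter] at hz ⊢
      exact ⟨Finset.mem_univ _, fun h => hz.2 ((hflip z).1 h)⟩
    · intro z hz
      rw [Finset.mem_filter] at hz ⊢
      exact ⟨Finset.mem_univ _, (hflip z).2 (not_ne_iff.1 hz.2)⟩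
    · intro z _
      funext i
      simp only [flipAt, Function.update_apply]
      split_ifs with h <;> simp [h]
    · intro z _
      funext i
      simp only [flipAt, Function.update_apply]
      split_ifs with h <;> simp [h]
  have h := Finset.card_filter_add_card_filter_not (s := (Finset.univ : Finset (V → Bool)))
    (fun z : V → Bool => z a ≠ z b)
  rw [Finset.card_univ, Fintype.card_fun, Fintype.card_bool] at h
  omega

/-- **Linearity of expectation, counted exactly: `Σ_z C(z) = |E| · 2^{n−1}`**, i.e. the average cut of
a uniformly random string is `|E|/2`. [cite: Jukna2011, Thm. 26.1 (“E[X] = Σ_e E[X_e] = |E|/2”)] -/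
theorem two_mul_sum_cutValue : 2 * ∑ z : V → Bool, cutValue G z = #G.edgeFinset * 2 ^ Fintype.card V := by
  simp only [cutValue]
  rw [Finset.sum_comm, Finset.mul_sum,
    show #G.edgeFinset * 2 ^ Fintype.card V = ∑ _e ∈ G.edgeFinset, 2 ^ Fintype.card V by
      rw [Finset.sum_const, smul_eq_mul]]
  refine Finset.sum_congr rfl fun e he => ?_
  induction e using Sym2.ind with
  | h a b =>
    have hab : a ≠ b := (SimpleGraph.mem_edgeFinset.1 he).ne
    simp only [cutInd_mk]
    rw [Finset.sum_ite, Finset.sum_const_zero, zero_add, Finset.sum_const, smul_eq_mul, mul_one]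
    exact two_mul_card_filter_ne hab

/-- **`F_0 = |E|/2`:** with no layers QAOA returns a uniformly random string, whose expected cut is half
the edges. [cite: FarhiGoldstoneGutmann2014, eqs. (5), (7)] [cite: Jukna2011, Thm. 26.1 (E[X] = |E|/2)]
[cite: Hastings2019BoundedDepth, §3 (“improves by a factor δ over random if the expected fraction of cut edges is
at least 1/2 + δ”)] -/
theorem meanCut_zero (γ β : Fin 0 → ℝ) : meanCut G 0 γ β = #G.edgeFinset / 2 := by
  unfold meanCut
  simp_rw [outcomeProb_zero, ← Finset.sum_mul]
  have h := two_mul_sum_cutValue G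
  have h' : (2 : ℝ) * ∑ z : V → Bool, (cutValue G z : ℝ) = #G.edgeFinset * 2 ^ Fintype.card V := by
    exact_mod_cast h
  have h2 : (0 : ℝ) < 2 ^ Fintype.card V := by positivity
  field_simp
  linarith

/-- `M_0 = |E|/2`. [cite: FarhiGoldstoneGutmann2014, eq. (8) at p = 0] [cite: Jukna2011, Thm. 26.1] -/
theorem maxLevel_zero : maxLevel G 0 = #G.edgeFinset / 2 := by
  refine le_antisymm (ciSup_le fun a => (meanCut_zero G a.1 a.2).le) ?_
  have h := meanCut_le_maxLevel G 0 (fun i => i.elim0) (fun i => i.elim0)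
  rwa [meanCut_zero] at h

/-- **QAOA at any level is at least the random-assignment baseline: `M_p ≥ |E|/2`** (from
`M_p ≥ M_{p−1}`, eq. (9), down to `M_0 = |E|/2`). [cite: FarhiGoldstoneGutmann2014, eq. (9)] [cite:
Jukna2011, Thm. 26.1] [cite: Hastings2019BoundedDepth, §3 (improvement “over random”)] -/
theorem half_card_le_maxLevel (p : ℕ) : (#G.edgeFinset : ℝ) / 2 ≤ maxLevel G p := by
  induction p with
  | zero => exact (maxLevel_zero G).ge
  | succ p ih => exact ih.trans (maxLevel_mono G p)

end QAOA

end Literature.Computability.QuantumComplexity
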